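import Mathlib
import Summits.MatrixMultiplication.Statement
import Summits.MatrixMultiplication.MatrixMultiplication.Theorems.GraphEquationsExactAffine

/-!
# Graph equations — the level-2 engine WITH OUTPUT SELECTION (M19r)

NODE-g32 REV 13: the level-2 engine of M19o asks V0/V1 for the deflated versions of ALL tests; that is too
much (explicit system on which no admissible field pair exists at any max-rank base, while selecting the
outputs rescues it: `t = (f̃₁₁ + β f̃₁₂ + f̃₁₂², f̃₁₂³, f̃₂₁, f̃₂₂)`).  Only the tests in the SUPPORTS of the
chains used need to be differentiated.  This module proves the engine with a selection `e : Fin T₁ → Fin T`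
of the tests that are deflated: V0/V1 are required only for `D₁(t∘e)`, `D₂(t∘e)`, `D₂D₁(t∘e)`; the alive
branch asks for a cube certificate supported on the selection; the served branch may use every test and
every selected output.  Same bound `R(⟨n,n,n⟩) ≤ 18N`.

* `tensorRank_le_of_cubeMembers_affine2_sel`.
-/

set_option linter.dupNamespace false

noncomputable section

open scoped BigOperators

namespace Summit.MatrixMultiplication.MatrixMultiplication.Theorems.GraphEquations

open MvPolynomial
open Literature.Computability.AlgebraicComplexity
open Literature.Computability.AlgebraicComplexity.ArithCircuit

variable {n : ℕ}

/-- **LEVEL-2 ENGINE WITH OUTPUT SELECTION (e = 3).**  See the module docstring. -/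
theorem tensorRank_le_of_cubeMembers_affine2_sel {N T T₁ : ℕ} (t : Fin T → MvPolynomial (GraphVars n) ℂ)
    (hspan : ∃ gs : List (MvPolynomial (GraphVars n) ℂ), IsNonscalarSeq gs ∧ gs.length ≤ N ∧
      ∀ o, t o ∈ freeSpan {q | q ∈ gs})
    (ht : ∀ o, t o ∈ graphIdeal n)
    (e : Fin T₁ → Fin T)
    (ξ₁ ξ₂ : Fin n × Fin n → MvPolynomial (MatMulVars n) ℂ)
    (hξ₁ : ∀ q, liftAB n (ξ₁ q) ∈ freeSpan (∅ : Set (MvPolynomial (GraphVars n) ℂ)))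
    (hξ₂ : ∀ q, liftAB n (ξ₂ q) ∈ freeSpan (∅ : Set (MvPolynomial (GraphVars n) ℂ)))
    (hV0₁ : ∀ i, coeff 0 (derivC ξ₁ (t (e i))) = 0)
    (hV1₁ : ∀ i (v : MatMulVars n),
      coeff (Finsupp.single (Sum.inl v : GraphVars n) 1) (derivC ξ₁ (t (e i))) = 0)
    (hV0₂ : ∀ i, coeff 0 (derivC ξ₂ (t (e i))) = 0 ∧ coeff 0 (derivC ξ₂ (derivC ξ₁ (t (e i)))) = 0)
    (hV1₂ : ∀ i (v : MatMulVars n),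
      coeff (Finsupp.single (Sum.inl v : GraphVars n) 1) (derivC ξ₂ (t (e i))) = 0 ∧
        coeff (Finsupp.single (Sum.inl v : GraphVars n) 1) (derivC ξ₂ (derivC ξ₁ (t (e i)))) = 0)
    (hq : ∀ q : Fin n × Fin n,
      (coeff 0 (ξ₁ q) ≠ 0 ∧ coeff 0 (ξ₂ q) ≠ 0 ∧
        ∃ (g : MvPolynomial (MatMulVars n) ℂ) (h : Fin T₁ → MvPolynomial (GraphVars n) ℂ),
          coeff 0 g ≠ 0 ∧ ∑ i, h i * t (e i) = liftAB n g * generator n q ^ 3) ∨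
      (∃ (P₀ : Fin T → ℂ) (P₁ P₂ P₃ : Fin T₁ → ℂ) (r : MvPolynomial (GraphVars n) ℂ),
          (∀ q' : Fin n × Fin n, coeff (Finsupp.single (Sum.inr q' : GraphVars n) 1) r = 0) ∧
          (∀ i j j' l : Fin n, coeff (Finsupp.single (Sum.inl (Sum.inl (i, j)) : GraphVars n) 1 +
              Finsupp.single (Sum.inl (Sum.inr (j', l)) : GraphVars n) 1) r = 0) ∧
          ∑ o, C (P₀ o) * t o + ∑ i, C (P₁ i) * derivC ξ₁ (t (e i)) +
              ∑ i, C (P₂ i) * derivC ξ₂ (t (e i)) +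
              ∑ i, C (P₃ i) * derivC ξ₂ (derivC ξ₁ (t (e i))) = generator n q + r)) :
    tensorRank (matMulTensor ℂ n n n) ≤ 2 * (9 * N) := by
  classical
  -- selected tests and their level-1 / level-2 output families
  set s : Fin T₁ → MvPolynomial (GraphVars n) ℂ := fun i => t (e i) with hs
  set p₁ : Fin T₁ ⊕ Fin T₁ → MvPolynomial (GraphVars n) ℂ := Sum.elim s fun i => derivC ξ₁ (s i) with hp₁
  set p₂ : (Fin T₁ ⊕ Fin T₁) ⊕ (Fin T₁ ⊕ Fin T₁) → MvPolynomial (GraphVars n) ℂ :=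
    Sum.elim p₁ fun o => derivC ξ₂ (p₁ o) with hp₂
  set p : Fin T ⊕ ((Fin T₁ ⊕ Fin T₁) ⊕ (Fin T₁ ⊕ Fin T₁)) → MvPolynomial (GraphVars n) ℂ :=
    Sum.elim t p₂ with hp
  -- nonscalar length `≤ 9N`
  obtain ⟨gs, hns, hlen, hmem⟩ := hspan
  obtain ⟨gs₁, hns₁, hlen₁, hsub₁, hD₁⟩ := IsNonscalarSeq.derivC_affine ξ₁ hξ₁ hns
  obtain ⟨gs₂, hns₂, hlen₂, hsub₂, hD₂⟩ := IsNonscalarSeq.derivC_affine ξ₂ hξ₂ hns₁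
  have hmem₁ : ∀ o, p₁ o ∈ freeSpan {q | q ∈ gs₁} := by
    rintro (i | i)
    · exact hsub₁ _ (hmem (e i))
    · exact hD₁ _ (hmem (e i))
  have hspan' : ∃ gs' : List (MvPolynomial (GraphVars n) ℂ), IsNonscalarSeq gs' ∧
      gs'.length ≤ 9 * N ∧ ∀ o, p o ∈ freeSpan {q | q ∈ gs'} := by
    refine ⟨gs₂, hns₂, hlen₂.trans (by omega), ?_⟩
    rintro (o | (o | o))
    · exact hsub₂ _ (hsub₁ _ (hmem o))
    · exact hsub₂ _ (hmem₁ o)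
    · exact hD₂ _ (hmem₁ o)
  -- (V0), (V1)
  have h0 : ∀ o, coeff 0 (p o) = 0 := by
    rintro (o | ((i | i) | (i | i)))
    · exact coeff_zero_eq_zero_of_mem_graphIdeal (ht o)
    · exact coeff_zero_eq_zero_of_mem_graphIdeal (ht (e i))
    · exact hV0₁ i
    · exact (hV0₂ i).1
    · exact (hV0₂ i).2
  have h1 : ∀ o (v : MatMulVars n), coeff (Finsupp.single (Sum.inl v : GraphVars n) 1) (p o) = 0 := by
    rintro (o | ((i | i) | (i | i))) v
    · exact coeff_single_inl_eq_zero_of_mem_graphIdeal (ht o) v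
    · exact coeff_single_inl_eq_zero_of_mem_graphIdeal (ht (e i)) v
    · exact hV1₁ i v
    · exact (hV1₂ i v).1
    · exact (hV1₂ i v).2
  -- member identities
  have hex : ∀ q : Fin n × Fin n,
      ∃ (hh : Fin T ⊕ ((Fin T₁ ⊕ Fin T₁) ⊕ (Fin T₁ ⊕ Fin T₁)) → MvPolynomial (GraphVars n) ℂ)
      (uu rr : MvPolynomial (GraphVars n) ℂ), coeff 0 uu ≠ 0 ∧
        (∀ q' : Fin n × Fin n, coeff (Finsupp.single (Sum.inr q' : GraphVars n) 1) rr = 0) ∧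
        (∀ i j j' l : Fin n, coeff (Finsupp.single (Sum.inl (Sum.inl (i, j)) : GraphVars n) 1 +
            Finsupp.single (Sum.inl (Sum.inr (j', l)) : GraphVars n) 1) rr = 0) ∧
        ∑ o, hh o * p o = uu * generator n q + rr := by
    intro q
    rcases hq q with ⟨hξ₁q, hξ₂q, g, h, hg, hid⟩ | ⟨P₀, P₁, P₂, P₃, r, hrc, hrab, hid⟩
    · have hid₁ := exactMember_step_sum ξ₁ s h g q 2 hid
      have hid₁' : ∑ o', Sum.elim (fun i => derivC ξ₁ (h i)) h o' * p₁ o' =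
          liftAB n (C (((2 + 1 : ℕ) : ℂ)) * (g * ξ₁ q)) * generator n q ^ (1 + 1) := by
        rw [hp₁, hid₁]
        simp only [map_mul, liftAB_C]
      have hid₂ := exactMember_step_sum ξ₂ p₁ (Sum.elim (fun i => derivC ξ₁ (h i)) h)
        (C (((2 + 1 : ℕ) : ℂ)) * (g * ξ₁ q)) q 1 hid₁'
      refine ⟨Sum.elim (fun _ => 0) (Sum.elim (fun o => derivC ξ₂ (Sum.elim (fun i => derivC ξ₁ (h i)) h o))
          (Sum.elim (fun i => derivC ξ₁ (h i)) h)),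
        C (((1 + 1 : ℕ) : ℂ)) * liftAB n (C (((2 + 1 : ℕ) : ℂ)) * (g * ξ₁ q) * ξ₂ q), 0, ?_,
        fun _ => coeff_zero _, fun _ _ _ _ => coeff_zero _, ?_⟩
      · rw [coeff_zero_mul_eq, coeff_zero_C, coeff_zero_liftAB, coeff_zero_mul_eq, coeff_zero_mul_eq,
          coeff_zero_C, coeff_zero_mul_eq]
        exact mul_ne_zero (by norm_num) (mul_ne_zero (mul_ne_zero (by norm_num) (mul_ne_zero hg hξ₁q)) hξ₂q)
      · rw [add_zero, hp, Fintype.sum_sum_type]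
        simp only [Sum.elim_inl, Sum.elim_inr, zero_mul, Finset.sum_const_zero, zero_add]
        rw [hp₂, hid₂, pow_one]
    · refine ⟨Sum.elim (fun o => C (P₀ o)) (Sum.elim (Sum.elim (fun _ => 0) fun i => C (P₁ i))
          (Sum.elim (fun i => C (P₂ i)) fun i => C (P₃ i))), 1, r, by simp, hrc, hrab, ?_⟩
      rw [Fintype.sum_sum_type, Fintype.sum_sum_type, Fintype.sum_sum_type, Fintype.sum_sum_type]
      simp only [hp, hp₂, hp₁, hs, Sum.elim_inl, Sum.elim_inr, one_mul, zero_mul,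
        Finset.sum_const_zero, zero_add]
      rw [← hid]
      ring
  choose hh uu rr huu hrc hrab hid using hex
  exact tensorRank_le_of_exactMembers_mod p hspan' h0 h1 hh uu huu rr hrc hrab hid

end Summit.MatrixMultiplication.MatrixMultiplication.Theorems.GraphEquations

end
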